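import Summits.Ventures.PercRepro.C026GluingEveryP
import Summits.Ventures.PercRepro.C026GluingN

/-!
# C-026 at every `p` on a gluing with any number of parts (p6, gen 9)

The every-`p` composition theorem `c026_of_gluing_of_dFree_minors` (`C026GluingEveryP.lean`) gives
C-026 at every `p ∈ [0,1]^E` on a two-part gluing whose parts have D-free marked minors (face-closed
D-free families).  This file iterates it over any number of colour classes, as `C026GluingN.lean`
iterates the composition theorem itself:

* **transport of marked minors** along an endpoint-preserving bijection of edge types: the sure classes
  correspond (`minorMap`, a bijection of the quotients), the free edges correspond (`faceEquivOf`), so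
  the D-free inequality on a marked minor transports (`dFreeIneq_minor_edgeEquiv`);
* `dFreeIneq_minor_of_gluing` — every marked minor of a two-part gluing is D-free when every marked
  minor of each part is (the landed `isGluing_minor`, `dFreeIneq_part_minor_of_minor_part`,
  `dFreeIneq_of_marks_eq` and the composition theorem, assembled);
* **`dFreeIneq_minor_colSub`** (induction on the finset of colours) and
  **`c026_of_gluingN_of_dFree_minors`** — C-026 at every `p` on an `ι`-coloured gluing whose colour
  classes have D-free marked minors — with its instance `c026_of_gluingFin_of_dFree_minors`.
-/

namespace PercRepro

namespace MultiGraph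

section MinorTransport

variable {V E₁ E₂ : Type*} {A : MultiGraph V E₁} {B : MultiGraph V E₂} {ε : E₁ ≃ E₂}

variable (hfst : ∀ e, B.fst (ε e) = A.fst e) (hsnd : ∀ e, B.snd (ε e) = A.snd e)

/-- The free edges of the pulled-back configurations are the free edges, through `ε`. -/
def faceEquivOf (ε : E₁ ≃ E₂) (u v : Config E₂) :
    Face (pullConfig ε u) (pullConfig ε v) ≃ Face u v where
  toFun e := ⟨ε e.1, e.2⟩
  invFun e := ⟨ε.symm e.1, by simpa [pullConfig] using e.2⟩
  left_inv e := by
    ext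
    simp
  right_inv e := by
    ext
    simp

include hfst hsnd in
/-- Connectivity corresponds along an endpoint-preserving edge bijection, for all vertices (the vertex
map is the identity; the same statement as `conn_edgeEquiv_iff` of `C026PinnedN.lean`, kept private here so
that the every-`p` gluing theorem does not depend on the pinned package). -/
private theorem conn_edgeEquiv_iff' (ω : Config E₂) (u v : V) :
    A.Conn (pullConfig ε ω) u v ↔ B.Conn ω u v := by
  constructor
  · exact conn_map (φ := id) hfst hsnd
  · intro h
    unfold Conn at h ⊢
    induction h with
    | refl => exact Relation.ReflTransGen.refl
    | tail _ hxy ih =>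
      obtain ⟨f, hf, hend⟩ := hxy
      refine ih.tail ⟨ε.symm f, ?_, ?_⟩
      · simpa [pullConfig] using hf
      · have h1 := hfst (ε.symm f)
        have h2 := hsnd (ε.symm f)
        rw [Equiv.apply_symm_apply] at h1 h2
        rw [← h1, ← h2]
        exact hend

include hfst hsnd in
/-- **The sure classes correspond**: the identity on vertices descends to the quotients by sure
connectivity. -/
def minorMap (v : Config E₂) :
    Quotient (A.connSetoid (pullConfig ε v)) → Quotient (B.connSetoid v) :=
  Quotient.map' id fun ⦃x y⦄ h => (conn_edgeEquiv_iff' hfst hsnd v x y).mp h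

include hfst hsnd in
/-- The map on sure classes sends the class of `x` to the class of `x`. -/
theorem minorMap_sureClass (v : Config E₂) (x : V) :
    minorMap hfst hsnd v (A.sureClass (pullConfig ε v) x) = B.sureClass v x := rfl

include hfst hsnd in
/-- The map on sure classes is injective (the setoids correspond). -/
theorem minorMap_injective (v : Config E₂) : Function.Injective (minorMap hfst hsnd v) := by
  intro q₁ q₂ h
  induction q₁ using Quotient.inductionOn' with
  | h x =>
    induction q₂ using Quotient.inductionOn' with
    | h y =>
      have h' : B.Conn v x y := Quotient.exact' h
      exact Quotient.sound' ((conn_edgeEquiv_iff' hfst hsnd v x y).mpr h')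

include hfst hsnd in
/-- The minors correspond edge by edge (first endpoints). -/
theorem minor_fst_edgeEquiv (u v : Config E₂) (e : Face (pullConfig ε u) (pullConfig ε v)) :
    (B.minor u v).fst (faceEquivOf ε u v e) =
      minorMap hfst hsnd v ((A.minor (pullConfig ε u) (pullConfig ε v)).fst e) := by
  show B.sureClass v (B.fst (ε e.1)) = minorMap hfst hsnd v (A.sureClass _ (A.fst e.1))
  rw [hfst, minorMap_sureClass]

include hfst hsnd in
/-- The minors correspond edge by edge (second endpoints). -/
theorem minor_snd_edgeEquiv (u v : Config E₂) (e : Face (pullConfig ε u) (pullConfig ε v)) :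
    (B.minor u v).snd (faceEquivOf ε u v e) =
      minorMap hfst hsnd v ((A.minor (pullConfig ε u) (pullConfig ε v)).snd e) := by
  show B.sureClass v (B.snd (ε e.1)) = minorMap hfst hsnd v (A.sureClass _ (A.snd e.1))
  rw [hsnd, minorMap_sureClass]

include hfst hsnd in
/-- **The D-free inequality on a marked minor transports** along an endpoint-preserving bijection of
edge types. -/
theorem dFreeIneq_minor_edgeEquiv [Fintype E₁] [DecidableEq E₁] [Fintype E₂] [DecidableEq E₂]
    (u v : Config E₂) (a b c : V)
    (h : (A.minor (pullConfig ε u) (pullConfig ε v)).DFreeIneq (A.sureClass (pullConfig ε v) a)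
      (A.sureClass (pullConfig ε v) b) (A.sureClass (pullConfig ε v) c)) :
    (B.minor u v).DFreeIneq (B.sureClass v a) (B.sureClass v b) (B.sureClass v c) :=
  dFreeIneq_map (ε := faceEquivOf ε u v) (φ := minorMap hfst hsnd v)
    (minor_fst_edgeEquiv hfst hsnd u v) (minor_snd_edgeEquiv hfst hsnd u v)
    (fun _ _ _ _ h => minorMap_injective hfst hsnd v h) h

end MinorTransport

section GluingNEveryP

variable {V E ι : Type*}

/-- **Every marked minor of a two-part gluing is D-free** when every marked minor of each part is:
coinciding marks by `dFreeIneq_of_marks_eq`, otherwise the minor is a gluing (`isGluing_minor`) whose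
parts are D-free by `dFreeIneq_part_minor_of_minor_part`, and the composition theorem applies. -/
theorem dFreeIneq_minor_of_gluing [Fintype E] [DecidableEq E] (G : MultiGraph V E) (a b c : V)
    (side : E → Bool) (hg : G.IsGluing a b c side)
    (h₁ : ∀ u₁ v₁ : Config {e // side e = true}, v₁ ≤ u₁ →
      ((G.part side true).minor u₁ v₁).DFreeIneq ((G.part side true).sureClass v₁ a)
        ((G.part side true).sureClass v₁ b) ((G.part side true).sureClass v₁ c))
    (h₀ : ∀ u₀ v₀ : Config {e // side e = false}, v₀ ≤ u₀ →
      ((G.part side false).minor u₀ v₀).DFreeIneq ((G.part side false).sureClass v₀ a)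
        ((G.part side false).sureClass v₀ b) ((G.part side false).sureClass v₀ c))
    (u v : Config E) (huv : v ≤ u) :
    (G.minor u v).DFreeIneq (G.sureClass v a) (G.sureClass v b) (G.sureClass v c) := by
  by_cases hab : G.sureClass v a = G.sureClass v b
  · exact (G.minor u v).dFreeIneq_of_marks_eq (Or.inl hab)
  by_cases hac : G.sureClass v a = G.sureClass v c
  · exact (G.minor u v).dFreeIneq_of_marks_eq (Or.inr (Or.inl hac))
  by_cases hbc : G.sureClass v b = G.sureClass v c
  · exact (G.minor u v).dFreeIneq_of_marks_eq (Or.inr (Or.inr hbc))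
  exact dFreeIneq_of_gluing (G.minor u v) _ _ _ hab hac hbc (fun e => side e.1)
    (isGluing_minor hg u v)
    (dFreeIneq_part_minor_of_minor_part hg true u v hab hac hbc (h₁ _ _ fun e => huv e.1))
    (dFreeIneq_part_minor_of_minor_part hg false u v hab hac hbc (h₀ _ _ fun e => huv e.1))

variable (G : MultiGraph V E)

/-- **D-free marked minors on a finset of colours**: if every marked minor of every colour class with
colour in `s` is D-free, so is every marked minor of the subgraph of the edges of colour in `s`
(induction on `s`; the step is `dFreeIneq_minor_of_gluing` for «colour `i`» against «colour in `s`»,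
the minors of the parts transported by `dFreeIneq_minor_edgeEquiv`). -/
theorem dFreeIneq_minor_colSub [Fintype E] [DecidableEq E] [DecidableEq ι] (a b c : V)
    (col : E → ι) (hg : G.IsGluingN a b c col) (s : Finset ι)
    (h : ∀ i ∈ s, ∀ u v : Config {e // col e = i}, v ≤ u →
      ((G.colPart col i).minor u v).DFreeIneq ((G.colPart col i).sureClass v a)
        ((G.colPart col i).sureClass v b) ((G.colPart col i).sureClass v c)) :
    ∀ u v : Config {e // col e ∈ s}, v ≤ u →
      ((G.colSub col s).minor u v).DFreeIneq ((G.colSub col s).sureClass v a)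
        ((G.colSub col s).sureClass v b) ((G.colSub col s).sureClass v c) := by
  revert h
  refine Finset.induction_on s ?_ ?_
  · intro _ u v _
    haveI : IsEmpty {e // col e ∈ (∅ : Finset ι)} := ⟨fun e => Finset.notMem_empty _ e.2⟩
    haveI : IsEmpty (Face u v) := ⟨fun e => isEmptyElim e.1⟩
    exact dFreeIneq_of_isEmpty _ _ _ _
  · intro i s hi ih h u v huv
    refine dFreeIneq_minor_of_gluing (G.colSub col (insert i s)) a b c (colSide col i s)
      (G.isGluing_colSub a b c col hg i s) ?_ ?_ u v huv
    · intro u₁ v₁ huv₁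
      exact dFreeIneq_minor_edgeEquiv (ε := colEquivTrue col i s) (fun _ => rfl) (fun _ => rfl)
        u₁ v₁ a b c
        (h i (Finset.mem_insert_self i s) _ _ fun e => huv₁ (colEquivTrue col i s e))
    · intro u₀ v₀ huv₀
      exact dFreeIneq_minor_edgeEquiv (ε := colEquivFalse col i s hi) (fun _ => rfl)
        (fun _ => rfl) u₀ v₀ a b c
        (ih (fun j hj => h j (Finset.mem_insert_of_mem hj)) _ _
          fun e => huv₀ (colEquivFalse col i s hi e))

/-- **C-026 AT EVERY `p` ON A GLUING WITH ANY NUMBER OF PARTS**: if the edges of `G` are coloured by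
`ι` so that every vertex other than the marks carries one colour, and every marked minor of every
colour class is D-free (face-closed D-free families on the parts), then C-026 holds on `G` at every
`p ∈ [0,1]^E`. -/
theorem c026_of_gluingN_of_dFree_minors [Fintype E] [DecidableEq E] [Fintype ι] [DecidableEq ι]
    (a b c : V) (col : E → ι) (hg : G.IsGluingN a b c col)
    (h : ∀ i, ∀ u v : Config {e // col e = i}, v ≤ u →
      ((G.colPart col i).minor u v).DFreeIneq ((G.colPart col i).sureClass v a)
        ((G.colPart col i).sureClass v b) ((G.colPart col i).sureClass v c))
    (p : E → ℝ) (hp : IsProb p) :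
    (G.law3 p a b c 0 + G.law3 p a b c 1) * (G.law3 p a b c 1 + G.law3 p a b c 4) ≤
      G.law3 p a b c 1 + G.law3 p a b c 2 + G.law3 p a b c 3 := by
  refine c026_of_dFree_minors G a b c (fun u v huv => ?_) p hp
  exact dFreeIneq_minor_edgeEquiv (ε := Equiv.subtypeUnivEquiv fun e => Finset.mem_univ (col e))
    (fun _ => rfl) (fun _ => rfl) u v a b c
    (G.dFreeIneq_minor_colSub a b c col hg Finset.univ (fun i _ => h i) _ _ fun e => huv _)

/-- **C-026 at every `p` on a gluing with `n` parts** (`Fin n`). -/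
theorem c026_of_gluingFin_of_dFree_minors [Fintype E] [DecidableEq E] (n : ℕ) (a b c : V)
    (col : E → Fin n) (hg : G.IsGluingN a b c col)
    (h : ∀ i, ∀ u v : Config {e // col e = i}, v ≤ u →
      ((G.colPart col i).minor u v).DFreeIneq ((G.colPart col i).sureClass v a)
        ((G.colPart col i).sureClass v b) ((G.colPart col i).sureClass v c))
    (p : E → ℝ) (hp : IsProb p) :
    (G.law3 p a b c 0 + G.law3 p a b c 1) * (G.law3 p a b c 1 + G.law3 p a b c 4) ≤
      G.law3 p a b c 1 + G.law3 p a b c 2 + G.law3 p a b c 3 :=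
  G.c026_of_gluingN_of_dFree_minors a b c col hg h p hp

end GluingNEveryP

end MultiGraph

end PercRepro
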